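/-
Copyright (c) 2026. All rights reserved.
Released under Apache 2.0 license as described in the file LICENSE.
-/
import Literature.Probability.FitznerVanDerHofstad2017.SrwTwoCosineInsertion
import Literature.Probability.FitznerVanDerHofstad2017.SrwRegionSplitAxis
import Literature.Probability.FitznerVanDerHofstad2017.SrwIntegralLZero
import Literature.Probability.FitznerVanDerHofstad2017.SrwReturnMomentBound
import HarnessLib

/-!
# The exact supremum of `K_{0,2}` over the cone `{‖x‖₁ ≥ 2}`, every `d ≥ 10`

Main theorem **`srwK_zero_two_le_kappa_div (hd : 10 ≤ d) (x) (hx : 2 ≤ Σ|x_μ|) :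
K_{0,2}(x) ≤ κ_d/(2d)`**, `κ_d = K_{0,0}(e_0) = ∫|D̂| dP/(2π)^d`; equality holds on the whole axis
family `m e_i`, `|m| ≥ 2` (`SrwTwoCosineInsertion.srwK_zero_two_single_eq_kappa_div`), so
`sup_{‖x‖₁ ≥ 2} K_{0,2}(x) = κ_d/(2d)` for every `d ≥ 10` — a d-generic statement (no dimension-specific
number; what-if / input-certification lane).

Ingredients, all proved here and d-generic:
* `section AxisFamilyWiring` — the axis family `K_{0,2}(a e₀) = κ_d/(2d)` (`a ≥ 2`) wired into
  `SrwRegionSplitAxis.le_of_axis_or_multi`: `srwK_zero_two_le_of_kappa_of_multi`.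
* `section SupAssembly` — `srwK_zero_two_le_kappa_div_of_inputs`: the bound from three inputs
  (`L_0 ≤ 1/(2d(d-1))` on the multi-support cone, `I_{0,4}(0) = 3(2d-1)/(8d³)`, `κ_d² ≥ 1/(3(2d-1))`)
  via Cauchy–Schwarz `srwK_le_sqrt_srwI_mul_srwL`; the resulting inequality
  `9(2d-1)² ≤ 4d²(d-1)`-type cubic holds iff `d ≥ 10`.
* stabiliser count on the multi-support cone: `card_stab_le_suppPreserving`, transitivity of
  `Perm (Fin d)` on `s`-subsets (`card_perm_image_eq`, via `Equiv.extendSubtype`),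
  `choose_mul_card_perm_image_self : C(d,s)·#{τ : τ(S) = S} = d!`, the numeric
  `two_mul_mul_pred_le_two_pow_mul_choose : 2d(d-1) ≤ 2^s·C(d,s)` (`2 ≤ s ≤ d`, `6 ≤ d`; `d = 5`,
  `s = 5` fails), hence `two_mul_mul_pred_mul_card_stab_le : 2d(d-1)·#Stab(x) ≤ 2^d·d!` and
  **`srwL_zero_le_of_two_le_card_support : L_0(x) ≤ 1/(2d(d-1))`** (`d ≥ 6`, ≥ 2 non-zero coordinates;
  equality at `a(e_0+e_1)`), sharpening `SrwIntegralLZero.srwL_zero_le` (`1/(2d)`) off the axes.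
* moments: `GaussDom` values `cosMom` 2,3,4 and `sumMom d m` for `m ≤ 4`
  (`sumMom_four : Σ-moment = (2π)^d·3d(2d-1)/8`), **`integral_Dhat_pow_four : ∫D̂⁴ dP = (2π)^d·3(2d-1)/(8d³)`**,
  `srwI_zero_four_zero : I_{0,4}(0) = 3(2d-1)/(8d³)`, `srwI_zero_two_zero : I_{0,2}(0) = 1/(2d)`.
* Littlewood device: `three_mul_sq_mul_integral_Dhat_sq_le : 3λ²∫D̂² ≤ 2λ³∫|D̂| + ∫D̂⁴` and
  **`one_div_le_srwK_zero_zero_single_sq : 1/(3(2d-1)) ≤ κ_d²`** (`λ² = 3(2d-1)/(4d²)`).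

Sources: Fitzner–van der Hofstad, *Mean-field behavior for nearest-neighbor percolation in d > 10*
[FitznerVanDerHofstad2016NoBLE], (3.34)–(3.36) p. 1071 (the SRW integrals and `κ`-type constants),
(5.15)–(5.16) p. 1092 (`I_{n,l}`, `K_{n,l}`, the orbit sum `W`/`L`), Lemma 5.1 and §5.1 p. 1093
(the region split / monotone sup); the hyperoctahedral orbit–stabiliser count is elementary.
-/

noncomputable section

open MeasureTheory Set Filter Real Finset

namespace Literature.Probability.FitznerVanDerHofstad2017

open Literature.Barriers.CriticalPhenomena
open Literature.Barriers.CriticalPhenomena.Slade2006Prop53 (μI P)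

variable {d : ℕ}

section AxisFamilyWiring

/-- **Axis-family input for the region split** (`hax` of `le_of_axis_or_multi` /
`le_of_axisBound_single` at `m₀ = 2`): along the axis family `a e₀`, `a ≥ 2`,
`K_{0,2}(a e₀) = κ_d/(2d)` exactly, so any `A ≥ κ_d/(2d)` is an axis-family bound.
[cite: FitznerVanDerHofstad2016NoBLE, (3.36) p. 1071; (5.15)–(5.16) p. 1092] -/
theorem srwK_zero_two_vecOfParts_eq_kappa_div (hd : 2 ≤ d) (a : ℕ) (ha : 2 ≤ a) :
    srwK d 0 2 (vecOfParts d [a]) = srwK d 0 0 (Pi.single (⟨0, by omega⟩ : Fin d) 1) / (2 * d) := by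
  rw [vecOfParts_single_eq_single (by omega) a]
  exact srwK_zero_two_single_eq_kappa_div hd _ (by simp; omega)

/-- The `hax`-shaped corollary: `κ_d/(2d) ≤ A ⟹ K_{0,2}(a e₀) ≤ A` for all `a ≥ 2`.
[cite: FitznerVanDerHofstad2016NoBLE, (3.36) p. 1071; (5.15)–(5.16) p. 1092] -/
theorem srwK_zero_two_axis_le (hd : 2 ≤ d) (A : ℝ)
    (hA : srwK d 0 0 (Pi.single (⟨0, by omega⟩ : Fin d) 1) / (2 * d) ≤ A) :
    ∀ a : ℕ, 2 ≤ a → srwK d 0 2 (vecOfParts d [a]) ≤ A := fun a ha => by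
  rw [srwK_zero_two_vecOfParts_eq_kappa_div hd a ha]; exact hA

/-- **`sup_{‖x‖₁ ≥ 2} K_{0,2}` from `κ_d` and a multi-support cone bound**: if `κ_d/(2d) ≤ B` and
`K_{0,2}(y) ≤ B` on the sorted multi-support cone, then `K_{0,2}(x) ≤ B` whenever `Σ|x_μ| ≥ 2`.
[cite: FitznerVanDerHofstad2016NoBLE, (5.15)–(5.16) p. 1092 and §5.1 p. 1093] -/
theorem srwK_zero_two_le_of_kappa_of_multi (hd : 2 ≤ d) (B : ℝ)
    (hB : srwK d 0 0 (Pi.single (⟨0, by omega⟩ : Fin d) 1) / (2 * d) ≤ B)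
    (hmulti : ∀ y : Fin d → ℤ, Antitone y → (∀ i, 0 ≤ y i) → 2 ≤ suppCount y → (2 : ℤ) ≤ ∑ j, y j →
      srwK d 0 2 y ≤ B)
    (x : Fin d → ℤ) (hx : 2 ≤ ∑ j, |x j|) : srwK d 0 2 x ≤ B :=
  le_of_axis_or_multi (srwK d 0 2) (fun τ x => srwK_spAct 0 2 τ x) B (m₀ := 2) (by norm_num)
    (srwK_zero_two_axis_le hd B hB) (fun y hy h0 h2 hs => hmulti y hy h0 h2 (by exact_mod_cast hs)) x
    (by exact_mod_cast hx)

end AxisFamilyWiring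

section SupAssembly

/-- **Assembly from the three elementary inputs**: for `d ≥ 10`, if `L_0(y) ≤ 1/(2d(d-1))` on the
multi-support cone, `I_{0,4}(0) = 3(2d-1)/(8d³)` and `κ_d² ≥ 1/(3(2d-1))`, then
`K_{0,2}(x) ≤ κ_d/(2d)` for every `x` with `Σ|x_μ| ≥ 2` (with equality on the axis family).
[cite: FitznerVanDerHofstad2016NoBLE, (5.15)–(5.16) p. 1092 and §5.1 p. 1093] -/
theorem srwK_zero_two_le_kappa_div_of_inputs (hd : 10 ≤ d)
    (hL : ∀ y : Fin d → ℤ, 2 ≤ suppCount y → srwL d 0 y ≤ 1 / (2 * d * (d - 1)))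
    (hI4 : srwI d 0 4 0 = 3 * (2 * d - 1) / (8 * d ^ 3))
    (hκ0 : 0 ≤ srwK d 0 0 (Pi.single (⟨0, by omega⟩ : Fin d) 1))
    (hκ : 1 / (3 * (2 * d - 1)) ≤ srwK d 0 0 (Pi.single (⟨0, by omega⟩ : Fin d) 1) ^ 2)
    (x : Fin d → ℤ) (hx : 2 ≤ ∑ j, |x j|) :
    srwK d 0 2 x ≤ srwK d 0 0 (Pi.single (⟨0, by omega⟩ : Fin d) 1) / (2 * d) := by
  set κ := srwK d 0 0 (Pi.single (⟨0, by omega⟩ : Fin d) 1) with hκdef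
  have hd' : (10 : ℝ) ≤ d := by exact_mod_cast hd
  refine srwK_zero_two_le_of_kappa_of_multi (by omega) (κ / (2 * d)) le_rfl (fun y _ _ h2 _ => ?_) x hx
  have hcs := srwK_le_sqrt_srwI_mul_srwL (n := 0) (by omega) 2 y
  rw [show 2 * 2 = 4 from rfl, hI4] at hcs
  refine hcs.trans ?_
  have h2d1 : (0 : ℝ) ≤ 2 * d - 1 := by linarith
  rw [← Real.sqrt_mul (by positivity)]
  have hsq : κ / (2 * d) = Real.sqrt ((κ / (2 * d)) ^ 2) := by
    rw [Real.sqrt_sq (by positivity)]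
  rw [hsq]
  apply Real.sqrt_le_sqrt
  have hLy := hL y h2
  have hLnn : 0 ≤ srwL d 0 y := srwL_nonneg 0 y
  calc 3 * (2 * (d : ℝ) - 1) / (8 * (d : ℝ) ^ 3) * srwL d 0 y
      ≤ 3 * (2 * (d : ℝ) - 1) / (8 * (d : ℝ) ^ 3) * (1 / (2 * (d : ℝ) * ((d : ℝ) - 1))) := by
        gcongr
    _ ≤ (1 / (3 * (2 * (d : ℝ) - 1))) / (2 * (d : ℝ)) ^ 2 := by
        rw [div_mul_div_comm, div_div, div_le_div_iff₀ (by
          have : (0:ℝ) < d - 1 := by linarith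
          positivity) (by
          have : (0:ℝ) < 2 * d - 1 := by linarith
          positivity)]
        nlinarith [hd', sq_nonneg ((d : ℝ) - 10), mul_nonneg (by linarith : (0:ℝ) ≤ d - 10) (sq_nonneg (d : ℝ)),
          mul_nonneg (mul_nonneg (by linarith : (0:ℝ) ≤ d - 10) (sq_nonneg (d : ℝ))) (by linarith : (0:ℝ) ≤ d)]
    _ ≤ (κ / (2 * (d : ℝ))) ^ 2 := by
        rw [div_pow]
        gcongr

end SupAssembly

end Literature.Probability.FitznerVanDerHofstad2017

end


open Finset

namespace Literature.Probability.FitznerVanDerHofstad2017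

variable {d : ℕ}

/-- A stabilising `ρ = (π, δ)` of `x` maps the support of `x` onto itself, and its signs are forced on
the support: `#Stab(x) ≤ #{π : ∀ i, x i = 0 ↔ x (π i) = 0} · #{δ : δ = 1 on supp x}`. [folklore] -/
private theorem card_stab_le_suppPreserving (x : Fin d → ℤ) :
    (univ.filter fun ρ : SgnPermPair d => spAct ρ x = x).card ≤
      (univ.filter fun τ : Equiv.Perm (Fin d) => ∀ i, x i = 0 ↔ x (τ i) = 0).card *
        (univ.filter fun δ : Fin d → ℤˣ => ∀ i, x i ≠ 0 → δ i = 1).card := by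
  rw [← Finset.card_product]
  refine Finset.card_le_card_of_injOn (fun ρ => (ρ.1, fun i => if x i = 0 then ρ.2 i else 1))
    ?_ ?_
  · intro ρ hρ
    have hρ' : spAct ρ x = x := by
      have := Finset.mem_coe.mp hρ
      simp only [Finset.mem_filter, Finset.mem_univ, true_and] at this
      exact this
    simp only [Finset.mem_coe, Finset.mem_product, Finset.mem_filter, Finset.mem_univ, true_and]
    refine ⟨fun i => ?_, fun i hi => by rw [if_neg hi]⟩
    have h := congr_fun hρ' i
    rw [spAct_apply] at h
    constructor
    · intro h0
      rw [h0] at h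
      rcases mul_eq_zero.mp h with h1 | h1
      · exact absurd h1 (Units.ne_zero _)
      · exact h1
    · intro h0
      rw [h0, mul_zero] at h
      exact h.symm
  · intro ρ hρ ρ' hρ' h
    have e₁ : spAct ρ x = x := by
      have := Finset.mem_coe.mp hρ
      simp only [Finset.mem_filter, Finset.mem_univ, true_and] at this
      exact this
    have e₂ : spAct ρ' x = x := by
      have := Finset.mem_coe.mp hρ'
      simp only [Finset.mem_filter, Finset.mem_univ, true_and] at this
      exact this
    simp only [Prod.mk.injEq] at h
    obtain ⟨h₁, h₂⟩ := h
    refine Prod.ext h₁ (funext fun i => ?_)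
    have hi := congr_fun h₂ i
    by_cases hxi : x i = 0
    · simpa only [hxi, if_true] using hi
    · have e := congr_fun e₁ i
      have e' := congr_fun e₂ i
      rw [spAct_apply] at e e'
      rw [← h₁] at e'
      have hne : x (ρ.1 i) ≠ 0 := by
        intro h0; rw [h0, mul_zero] at e; exact hxi e.symm
      have hint : (ρ.2 i : ℤ) = (ρ'.2 i : ℤ) := by
        apply mul_right_cancel₀ hne
        rw [e, e']
      exact Units.ext hint

end Literature.Probability.FitznerVanDerHofstad2017

namespace Literature.Probability.FitznerVanDerHofstad2017

variable {d : ℕ}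

/-- Transitivity of `Perm (Fin d)` on `s`-subsets: the fibres of `τ ↦ S.image τ` all have the same size.
[folklore] -/
private theorem card_perm_image_eq (S T : Finset (Fin d)) (hT : T.card = S.card) :
    (univ.filter fun τ : Equiv.Perm (Fin d) => S.image τ = T).card =
      (univ.filter fun τ : Equiv.Perm (Fin d) => S.image τ = S).card := by
  classical
  -- a permutation `σ` with `σ(S) = T`
  have hc : Fintype.card {i // i ∈ S} = Fintype.card {i // i ∈ T} := by
    rw [Fintype.card_coe, Fintype.card_coe, hT]
  set e : {i // i ∈ S} ≃ {i // i ∈ T} := Fintype.equivOfCardEq hc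
  set σ : Equiv.Perm (Fin d) := e.extendSubtype with hσ
  have hσS : S.image σ = T := by
    apply Finset.eq_of_subset_of_card_le
    · intro j hj
      obtain ⟨i, hi, rfl⟩ := Finset.mem_image.mp hj
      exact e.extendSubtype_mem i hi
    · rw [Finset.card_image_of_injective _ σ.injective, hT]
  have hσT : T.image ⇑σ⁻¹ = S := by
    rw [← hσS, Finset.image_image]
    convert Finset.image_id (s := S) using 2
    funext i
    simp
  symm
  refine Finset.card_nbij' (fun τ => σ * τ) (fun τ => σ⁻¹ * τ) ?_ ?_ ?_ ?_
  · intro τ hτ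
    simp only [Finset.mem_coe, Finset.mem_filter, Finset.mem_univ, true_and] at hτ ⊢
    rw [Equiv.Perm.coe_mul, ← Finset.image_image, hτ, hσS]
  · intro τ hτ
    simp only [Finset.mem_coe, Finset.mem_filter, Finset.mem_univ, true_and] at hτ ⊢
    rw [Equiv.Perm.coe_mul, ← Finset.image_image, hτ, hσT]
  · intro τ _
    show σ⁻¹ * (σ * τ) = τ
    group
  · intro τ _
    show σ * (σ⁻¹ * τ) = τ
    group

/-- `C(d,s) · #{τ : τ(S) = S} = d!` for `S` of size `s`. [folklore] -/
private theorem choose_mul_card_perm_image_self (S : Finset (Fin d)) :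
    d.choose S.card * (univ.filter fun τ : Equiv.Perm (Fin d) => S.image τ = S).card = d.factorial := by
  classical
  have hmaps : Set.MapsTo (fun τ : Equiv.Perm (Fin d) => S.image τ)
      (↑(univ : Finset (Equiv.Perm (Fin d)))) (↑(univ.powersetCard S.card : Finset (Finset (Fin d)))) := by
    intro τ _
    exact Finset.mem_coe.mpr (Finset.mem_powersetCard.mpr
      ⟨Finset.subset_univ _, Finset.card_image_of_injective _ τ.injective⟩)
  have h := Finset.card_eq_sum_card_fiberwise hmaps
  rw [Finset.card_univ, Fintype.card_perm, Fintype.card_fin] at h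
  have hfib : ∀ T ∈ (univ.powersetCard S.card : Finset (Finset (Fin d))),
      ((univ : Finset (Equiv.Perm (Fin d))).filter fun τ : Equiv.Perm (Fin d) => S.image ⇑τ = T).card =
        (univ.filter fun τ : Equiv.Perm (Fin d) => S.image ⇑τ = S).card := by
    intro T hT
    exact card_perm_image_eq S T (Finset.mem_powersetCard.mp hT).2
  rw [h, Finset.sum_congr rfl hfib, Finset.sum_const, Finset.card_powersetCard, Finset.card_univ,
    Fintype.card_fin, smul_eq_mul]

/-- The support-preserving permutations are exactly those with `τ(S) = S`, `S = supp x`. [folklore] -/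
private theorem filter_suppPreserving_eq (x : Fin d → ℤ) :
    (univ.filter fun τ : Equiv.Perm (Fin d) => ∀ i, x i = 0 ↔ x (τ i) = 0) =
      (univ.filter fun τ : Equiv.Perm (Fin d) =>
        (univ.filter fun i => x i ≠ 0).image τ = (univ.filter fun i => x i ≠ 0)) := by
  classical
  ext τ
  simp only [Finset.mem_filter, Finset.mem_univ, true_and]
  constructor
  · intro h
    apply Finset.eq_of_subset_of_card_le
    · intro j hj
      obtain ⟨i, hi, rfl⟩ := Finset.mem_image.mp hj
      simp only [Finset.mem_filter, Finset.mem_univ, true_and] at hi ⊢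
      exact fun h0 => hi ((h i).mpr h0)
    · rw [Finset.card_image_of_injective _ τ.injective]
  · intro h i
    constructor
    · intro h0
      by_contra h1
      have : τ i ∈ (univ.filter fun i => x i ≠ 0) := by simp [h1]
      rw [← h] at this
      obtain ⟨i', hi', he⟩ := Finset.mem_image.mp this
      have := τ.injective he
      subst this
      simp only [Finset.mem_filter, Finset.mem_univ, true_and] at hi'
      exact hi' h0
    · intro h0
      by_contra h1
      have : τ i ∈ (univ.filter fun i => x i ≠ 0).image τ := Finset.mem_image.mpr ⟨i, by simp [h1], rfl⟩
      rw [h] at this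
      simp only [Finset.mem_filter, Finset.mem_univ, true_and] at this
      exact this h0

end Literature.Probability.FitznerVanDerHofstad2017

/-- `2d(d-1) ≤ 2^s · C(d,s)` for `2 ≤ s ≤ d`, `6 ≤ d` (the hyperoctahedral orbit of a point with `s ≥ 2`
non-zero coordinates has at least `2d(d-1)` elements; `d = 5, s = 5` fails: `32 < 40`). [folklore] -/
private theorem two_mul_mul_pred_le_two_pow_mul_choose {d : ℕ} (hd : 6 ≤ d) {s : ℕ} (hs : 2 ≤ s) (hsd : s ≤ d) :
    2 * d * (d - 1) ≤ 2 ^ s * d.choose s := by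
  induction d, hd using Nat.le_induction generalizing s with
  | base =>
    interval_cases s <;> decide
  | succ n hn ih =>
    rcases Nat.lt_or_ge s (n + 1) with h | h
    · -- 2 ≤ s ≤ n
      have hsn : s ≤ n := by omega
      obtain ⟨t, rfl⟩ : ∃ t, s = t + 1 := ⟨s - 1, by omega⟩
      rw [Nat.choose_succ_succ', mul_add (2 ^ (t + 1)) (n.choose t) (n.choose (t + 1))]
      -- 2^(t+1) C(n,t+1) ≥ 2n(n-1) by ih; 2^(t+1) C(n,t) ≥ 4n
      have h1 := ih hs hsn
      have h2 : 4 * n ≤ 2 ^ (t + 1) * n.choose t := by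
        rcases Nat.lt_or_ge t 2 with ht | ht
        · have ht1 : t = 1 := by omega
          subst ht1
          simp [Nat.choose_one_right]
        · have h3 := ih ht (by omega)
          have : 2 ^ (t + 1) * n.choose t = 2 * (2 ^ t * n.choose t) := by ring
          rw [this]
          have hn1 : 4 * n ≤ 2 * (2 * n * (n - 1)) := by
            have : 1 ≤ n - 1 := by omega
            nlinarith
          exact hn1.trans (by nlinarith)
      have e1 : n + 1 - 1 = n := by omega
      rw [e1]
      have hn' : 2 * (n + 1) * n = 2 * n * (n - 1) + 4 * n := by
        obtain ⟨m, rfl⟩ : ∃ m, n = m + 1 := ⟨n - 1, by omega⟩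
        simp only [Nat.add_sub_cancel]
        ring
      rw [hn']
      linarith [h1, h2]
    · -- s = n + 1
      have hs' : s = n + 1 := by omega
      subst hs'
      rw [Nat.choose_self, mul_one, show n + 1 - 1 = n from rfl]
      have h1 := ih (s := n) (by omega) le_rfl
      rw [Nat.choose_self, mul_one] at h1
      rw [pow_succ]
      have : 1 ≤ n - 1 := by omega
      have h4 : 2 * (n + 1) * n ≤ 2 * (2 * n * (n - 1)) := by
        obtain ⟨m, rfl⟩ : ∃ m, n = m + 1 := ⟨n - 1, by omega⟩
        simp only [Nat.add_sub_cancel] at h1 ⊢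
        nlinarith
      calc 2 * (n + 1) * n ≤ 2 * (2 * n * (n - 1)) := h4
        _ ≤ 2 ^ n * 2 := by nlinarith

namespace Literature.Probability.FitznerVanDerHofstad2017

open Finset

variable {d : ℕ}

/-- **Stabiliser count on the multi-support cone**: `2d(d-1) · #Stab(x) ≤ 2^d · d!` whenever `x` has at
least two non-zero coordinates and `d ≥ 6`. [cite: FitznerVanDerHofstad2016NoBLE, (5.16) p. 1092] -/
theorem two_mul_mul_pred_mul_card_stab_le (hd : 6 ≤ d) (x : Fin d → ℤ)
    (hx : 2 ≤ (univ.filter fun i : Fin d => x i ≠ 0).card) :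
    2 * d * (d - 1) * (univ.filter fun ρ : SgnPermPair d => spAct ρ x = x).card ≤
      2 ^ d * d.factorial := by
  classical
  have h1 := card_stab_le_suppPreserving x
  rw [filter_suppPreserving_eq x] at h1
  have h2 := choose_mul_card_perm_image_self (univ.filter fun i : Fin d => x i ≠ 0)
  have h3 := card_signs_fixed_le x
  have hS : (univ.filter fun i : Fin d => x i ≠ 0).card +
      (univ.filter fun i : Fin d => ¬ x i ≠ 0).card = d := by
    have h := Finset.card_filter_add_card_filter_not (s := (univ : Finset (Fin d)))
      (fun i => x i ≠ 0)
    rw [Finset.card_univ, Fintype.card_fin] at h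
    exact h
  have hsd : (univ.filter fun i : Fin d => x i ≠ 0).card ≤ d := by omega
  have h4 := two_mul_mul_pred_le_two_pow_mul_choose hd hx hsd
  generalize (univ.filter fun i : Fin d => x i ≠ 0).card = s at h2 hS hx hsd h4
  generalize (univ.filter fun i : Fin d => ¬ x i ≠ 0).card = z at h3 hS
  generalize (univ.filter fun τ : Equiv.Perm (Fin d) =>
    (univ.filter fun i : Fin d => x i ≠ 0).image ⇑τ = (univ.filter fun i : Fin d => x i ≠ 0)).card = a
    at h1 h2
  generalize (univ.filter fun δ : Fin d → ℤˣ => ∀ i, x i ≠ 0 → δ i = 1).card = b at h1 h3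
  calc 2 * d * (d - 1) * (univ.filter fun ρ : SgnPermPair d => spAct ρ x = x).card
      ≤ 2 * d * (d - 1) * (a * b) := Nat.mul_le_mul_left _ h1
    _ ≤ (2 ^ s * d.choose s) * (a * b) := Nat.mul_le_mul_right _ h4
    _ = 2 ^ s * (d.choose s * a) * b := by ring
    _ = 2 ^ s * d.factorial * b := by rw [h2]
    _ ≤ 2 ^ s * d.factorial * 2 ^ z := Nat.mul_le_mul_left _ h3
    _ = 2 ^ (s + z) * d.factorial := by rw [pow_add]; ring
    _ = 2 ^ d * d.factorial := by rw [hS]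

/-- **`L_0(x) ≤ 1/(2d(d-1))` on the multi-support cone** (`d ≥ 6`, `x` with ≥ 2 non-zero coordinates);
equality at `x = a(e_0 + e_1)`. [cite: FitznerVanDerHofstad2016NoBLE, (5.16) p. 1092] -/
theorem srwL_zero_le_of_two_le_card_support (hd : 6 ≤ d) (x : Fin d → ℤ)
    (hx : 2 ≤ (univ.filter fun i : Fin d => x i ≠ 0).card) :
    srwL d 0 x ≤ 1 / (2 * d * ((d : ℝ) - 1)) := by
  classical
  have hd1 : 1 ≤ d := by omega
  rw [srwL_zero_eq_card_stab hd1 x]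
  have h := two_mul_mul_pred_mul_card_stab_le hd x hx
  have hR : (2 * d * (d - 1) * ((univ.filter fun ρ : SgnPermPair d => spAct ρ x = x).card : ℕ) : ℝ) ≤
      ((2 ^ d * d.factorial : ℕ) : ℝ) := by exact_mod_cast h
  have hdR : (6 : ℝ) ≤ d := by exact_mod_cast hd
  have hsub : ((d - 1 : ℕ) : ℝ) = (d : ℝ) - 1 := by
    rw [Nat.cast_sub hd1]; simp
  push_cast [Nat.cast_sub hd1] at hR
  rw [div_le_div_iff₀ (by positivity) (by
    have : (0:ℝ) < (d:ℝ) - 1 := by linarith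
    positivity)]
  linarith

end Literature.Probability.FitznerVanDerHofstad2017


/-! ### Moments of the coordinate-cosine sum and the Littlewood lower bound for `κ_d`

Closed forms of the coordinate-cosine
moments `M_d(0) = (2π)^d`, `M_d(2) = (2π)^d · d/2`, `M_d(4) = (2π)^d · 3d(2d-1)/8`, hence
`∫ D̂⁴ dP = (2π)^d · 3(2d-1)/(8d³)`. -/

noncomputable section

open MeasureTheory Real Finset

namespace Literature.Probability.FitznerVanDerHofstad2017

open Literature.Barriers.CriticalPhenomena
open Literature.Barriers.CriticalPhenomena.Slade2006Prop53 (P μI)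
open GaussDom

/-- Auxiliary closed form / inequality `cosMom_two`. [folklore] -/
private theorem cosMom_two : cosMom 2 = π := by
  have h := cosMom_add_two 0
  rw [cosMom_zero] at h
  rw [show (2:ℕ) = 0 + 2 from rfl, h]
  push_cast
  ring

/-- Auxiliary closed form / inequality `cosMom_three`. [folklore] -/
private theorem cosMom_three : cosMom 3 = 0 := by
  simpa using cosMom_odd 1

/-- Auxiliary closed form / inequality `cosMom_four`. [folklore] -/
private theorem cosMom_four : cosMom 4 = 3 * π / 4 := by
  have h := cosMom_add_two 2
  rw [cosMom_two] at h
  rw [show (4:ℕ) = 2 + 2 from rfl, h]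
  push_cast
  ring

/-- Auxiliary closed form / inequality `sumMom_zero_right`. [folklore] -/
private theorem sumMom_zero_right (d : ℕ) : sumMom d 0 = (2 * π) ^ d := by
  induction d with
  | zero => rw [sumMom_zero_dim, pow_zero, pow_zero]
  | succ d ih =>
    rw [sumMom_succ, Finset.sum_range_one, Nat.choose_zero_right, Nat.cast_one, one_mul, cosMom_zero,
      Nat.sub_zero, ih, pow_succ]
    ring

/-- Auxiliary closed form / inequality `sumMom_one`. [folklore] -/
private theorem sumMom_one (d : ℕ) : sumMom d 1 = 0 := by
  induction d with
  | zero => rw [sumMom_zero_dim, pow_one]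
  | succ d ih =>
    rw [sumMom_succ]
    simp [Finset.sum_range_succ, cosMom_zero, cosMom_one, ih]

/-- Auxiliary closed form / inequality `sumMom_two`. [folklore] -/
private theorem sumMom_two (d : ℕ) : sumMom d 2 = (2 * π) ^ d * (d / 2) := by
  induction d with
  | zero => rw [sumMom_zero_dim]; simp
  | succ d ih =>
    rw [sumMom_succ]
    simp only [Finset.sum_range_succ, Finset.sum_range_zero, zero_add, Nat.choose_zero_right,
      Nat.choose_one_right, Nat.choose_self, Nat.cast_one, Nat.cast_ofNat, Nat.sub_zero,
      show 2 - 1 = 1 from rfl, Nat.sub_self, cosMom_zero, cosMom_one, cosMom_two, ih, sumMom_one,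
      sumMom_zero_right, pow_succ]
    push_cast
    ring

/-- Auxiliary closed form / inequality `sumMom_three`. [folklore] -/
private theorem sumMom_three (d : ℕ) : sumMom d 3 = 0 := by
  induction d with
  | zero => rw [sumMom_zero_dim]; simp
  | succ d ih =>
    rw [sumMom_succ]
    simp only [Finset.sum_range_succ, Finset.sum_range_zero, zero_add, Nat.choose_zero_right,
      Nat.choose_one_right, Nat.choose_self, Nat.cast_one, Nat.cast_ofNat, Nat.sub_zero,
      show 3 - 1 = 2 from rfl, show 3 - 2 = 1 from rfl, show Nat.choose 3 2 = 3 from rfl, Nat.sub_self,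
      cosMom_zero, cosMom_one, cosMom_two, cosMom_three, ih, sumMom_one, sumMom_two, sumMom_zero_right]
    ring

/-- `M_d(4) = ∫ (Σ_j cos k_j)⁴ dP = (2π)^d · 3d(2d-1)/8`. [cite: FitznerVanDerHofstad2016NoBLE, (5.15) p. 1092] -/
theorem sumMom_four (d : ℕ) : sumMom d 4 = (2 * π) ^ d * (3 * d * (2 * d - 1) / 8) := by
  induction d with
  | zero => rw [sumMom_zero_dim]; simp
  | succ d ih =>
    rw [sumMom_succ]
    simp only [Finset.sum_range_succ, Finset.sum_range_zero, zero_add, Nat.choose_zero_right,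
      Nat.choose_one_right, Nat.choose_self, Nat.cast_one, Nat.cast_ofNat, Nat.sub_zero,
      show 4 - 1 = 3 from rfl, show 4 - 2 = 2 from rfl, show 4 - 3 = 1 from rfl,
      show Nat.choose 4 2 = 6 from rfl, show Nat.choose 4 3 = 4 from rfl, Nat.sub_self,
      cosMom_zero, cosMom_one, cosMom_two, cosMom_three, cosMom_four, ih, sumMom_one, sumMom_two,
      sumMom_three, sumMom_zero_right, pow_succ]
    push_cast
    ring

/-- **`∫ D̂⁴ dP = (2π)^d · 3(2d-1)/(8d³)`** (`d ≥ 1`). [cite: FitznerVanDerHofstad2016NoBLE, (5.15) p. 1092] -/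
theorem integral_Dhat_pow_four (d : ℕ) (hd : 1 ≤ d) :
    ∫ k, Dhat d k ^ 4 ∂P d = (2 * π) ^ d * (3 * (2 * d - 1) / (8 * d ^ 3)) := by
  have hd0 : (d : ℝ) ≠ 0 := by exact_mod_cast (show d ≠ 0 by omega)
  have h : ∀ k : Fin d → ℝ, Dhat d k ^ 4 = (1 / d ^ 4) * cosCoordSum d k ^ 4 := by
    intro k
    rw [show Dhat d k = cosCoordSum d k / d by
      simp only [Dhat, cosCoordSum, Finset.sum_div]]
    field_simp
  simp_rw [h]
  rw [integral_const_mul, show (∫ k, cosCoordSum d k ^ 4 ∂P d) = sumMom d 4 from rfl, sumMom_four]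
  field_simp

/-- `∫ D̂² dP = (2π)^d / (2d)` (`d ≥ 1`), Bochner form. [folklore] -/
private theorem integral_Dhat_sq' (d : ℕ) (hd : 1 ≤ d) :
    ∫ k, Dhat d k ^ 2 ∂P d = (2 * π) ^ d / (2 * d) := by
  have hd0 : (d : ℝ) ≠ 0 := by exact_mod_cast (show d ≠ 0 by omega)
  have h : ∀ k : Fin d → ℝ, Dhat d k ^ 2 = (1 / d ^ 2) * cosCoordSum d k ^ 2 := by
    intro k
    rw [show Dhat d k = cosCoordSum d k / d by
      simp only [Dhat, cosCoordSum, Finset.sum_div]]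
    field_simp
  simp_rw [h]
  rw [integral_const_mul, show (∫ k, cosCoordSum d k ^ 2 ∂P d) = sumMom d 2 from rfl, sumMom_two]
  field_simp

variable {d : ℕ}

/-- Pointwise AM–GM behind Littlewood's inequality: `3λ² t² ≤ 2λ³ t + t⁴` for `t ≥ 0`, `λ ≥ 0`
(`t⁴ - 3λ²t² + 2λ³t = t (t - λ)² (t + 2λ)`). [folklore] -/
private theorem three_mul_sq_mul_sq_le (t lam : ℝ) (ht : 0 ≤ t) (hl : 0 ≤ lam) :
    3 * lam ^ 2 * t ^ 2 ≤ 2 * lam ^ 3 * t + t ^ 4 := by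
  nlinarith [mul_nonneg (mul_nonneg ht (sq_nonneg (t - lam))) (by positivity : 0 ≤ t + 2 * lam)]

/-- **Polynomial Littlewood device for `κ_d`**: for every `λ ≥ 0`,
`3λ² ∫ D̂² dP ≤ 2λ³ ∫ |D̂| dP + ∫ D̂⁴ dP`. [cite: FitznerVanDerHofstad2016NoBLE, (3.34)–(3.36) p. 1071] -/
theorem three_mul_sq_mul_integral_Dhat_sq_le (lam : ℝ) (hl : 0 ≤ lam) :
    3 * lam ^ 2 * ∫ k, Dhat d k ^ 2 ∂P d ≤ 2 * lam ^ 3 * ∫ k, |Dhat d k| ∂P d + ∫ k, Dhat d k ^ 4 ∂P d := by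
  have hc := continuous_Dhat d
  have hb : ∀ (n : ℕ), Integrable (fun k => |Dhat d k| ^ n) (P d) := fun n =>
    (integrable_const (1 : ℝ)).mono' (hc.abs.pow n).aestronglyMeasurable
      (ae_of_all _ fun k => by
        rw [Real.norm_eq_abs, abs_pow, abs_abs]
        exact pow_le_one₀ (abs_nonneg _) (abs_Dhat_le_one k))
  have h2 : Integrable (fun k => Dhat d k ^ 2) (P d) := by
    simpa only [sq_abs] using hb 2
  have h4 : Integrable (fun k => Dhat d k ^ 4) (P d) := by
    have := hb 4; simpa only [show ∀ x : ℝ, |x| ^ 4 = x ^ 4 from fun x => by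
      rw [show (4:ℕ) = 2 * 2 from rfl, pow_mul, pow_mul, sq_abs]] using this
  have h1 : Integrable (fun k => |Dhat d k|) (P d) := by simpa using hb 1
  rw [← integral_const_mul, ← integral_const_mul, ← integral_add (h1.const_mul _) h4]
  refine integral_mono (h2.const_mul _) ((h1.const_mul _).add h4) fun k => ?_
  have := three_mul_sq_mul_sq_le |Dhat d k| lam (abs_nonneg _) hl
  simp only [sq_abs] at this
  have h4' : |Dhat d k| ^ 4 = Dhat d k ^ 4 := by
    rw [show (4:ℕ) = 2 * 2 from rfl, pow_mul, pow_mul, sq_abs]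
  rw [h4'] at this
  simpa [mul_comm, mul_left_comm, mul_assoc] using this


/-- **Littlewood lower bound for `κ_d`** (squared form): `(∫|D̂| dP/(2π)^d)² ≥ 1/(3(2d-1))`, from
`3λ²D̂² ≤ 2λ³|D̂| + D̂⁴` at `λ² = 3(2d-1)/(4d²)` with `E D̂² = 1/(2d)`, `E D̂⁴ = 3(2d-1)/(8d³)`.
[cite: FitznerVanDerHofstad2016NoBLE, (3.34)–(3.36) p. 1071] -/
theorem one_div_le_sq_integral_abs_Dhat_div (hd : 1 ≤ d) :
    1 / (3 * (2 * (d : ℝ) - 1)) ≤ ((∫ k, |Dhat d k| ∂P d) / (2 * π) ^ d) ^ 2 := by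
  have hdR : (1 : ℝ) ≤ d := by exact_mod_cast hd
  have hdpos : (0 : ℝ) < d := by linarith
  have h2d1 : (0 : ℝ) < 2 * d - 1 := by linarith
  set K := ∫ k, |Dhat d k| ∂P d with hKdef
  have hK0 : 0 ≤ K := integral_nonneg fun k => abs_nonneg _
  set c : ℝ := 3 * (2 * d - 1) / (4 * d ^ 2) with hcdef
  have hc : 0 < c := by positivity
  set lam := Real.sqrt c with hlamdef
  have hlam0 : 0 ≤ lam := Real.sqrt_nonneg _
  have hlam2 : lam ^ 2 = c := Real.sq_sqrt hc.le
  have hlampos : 0 < lam := Real.sqrt_pos.mpr hc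
  have h := three_mul_sq_mul_integral_Dhat_sq_le (d := d) lam hlam0
  rw [integral_Dhat_sq' d hd, integral_Dhat_pow_four d hd] at h
  have hN : (0 : ℝ) < (2 * π) ^ d := by positivity
  -- h : 3 * lam ^ 2 * ((2π)^d / (2d)) ≤ 2 * lam ^ 3 * K + (2π)^d * (3 * (2d-1) / (8 d³))
  have hlam3 : lam ^ 3 = c * lam := by rw [pow_succ, hlam2]
  rw [hlam2, hlam3] at h
  -- main: 2 c lam K ≥ (2π)^d * 3(2d-1)/(4d³)
  have hE : (2 * π) ^ d * (3 * (2 * d - 1) / (4 * d ^ 3)) ≤ 2 * (c * lam) * K := by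
    have h1 : 3 * c * ((2 * π) ^ d / (2 * d)) - (2 * π) ^ d * (3 * (2 * d - 1) / (8 * d ^ 3))
        = (2 * π) ^ d * (3 * (2 * d - 1) / (4 * d ^ 3)) := by
      rw [hcdef]; field_simp; ring
    linarith
  -- square it
  have hE0 : 0 ≤ (2 * π) ^ d * (3 * (2 * d - 1) / (4 * d ^ 3)) := by positivity
  have hsq := mul_self_le_mul_self hE0 hE
  -- (2 c lam K)^2 = 4 c^3 K^2
  have h4 : 2 * (c * lam) * K * (2 * (c * lam) * K) = 4 * c ^ 3 * K ^ 2 := by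
    have : lam * lam = c := by rw [← sq, hlam2]
    calc 2 * (c * lam) * K * (2 * (c * lam) * K) = 4 * c ^ 2 * (lam * lam) * K ^ 2 := by ring
      _ = 4 * c ^ 3 * K ^ 2 := by rw [this]; ring
  rw [h4] at hsq
  -- identity: ((2π)^d E)^2 / (4 c^3) = (2π)^(2d) / (3(2d-1))
  rw [div_pow, div_le_div_iff₀ (by positivity) (by positivity)]
  have hid : (2 * π) ^ d * (3 * (2 * d - 1) / (4 * d ^ 3)) * ((2 * π) ^ d * (3 * (2 * d - 1) / (4 * d ^ 3)))
      = 4 * c ^ 3 * (((2 * π) ^ d) ^ 2 / (3 * (2 * d - 1))) := by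
    rw [hcdef]; field_simp
  rw [hid] at hsq
  have hc3 : (0 : ℝ) < 4 * c ^ 3 := by positivity
  have hK2 : ((2 * π) ^ d) ^ 2 / (3 * (2 * d - 1)) ≤ K ^ 2 := le_of_mul_le_mul_left hsq hc3
  rw [div_le_iff₀ (by positivity)] at hK2
  linarith

/-- Corollary in the `κ_d` normal form: `1/(3(2d-1)) ≤ κ_d²` with
`κ_d = K_{0,0}(e_i) = ∫|D̂| dP/(2π)^d`. [cite: FitznerVanDerHofstad2016NoBLE, (3.34)–(3.36) p. 1071] -/
theorem one_div_le_srwK_zero_zero_single_sq (hd : 1 ≤ d) (i : Fin d) :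
    1 / (3 * (2 * (d : ℝ) - 1)) ≤ srwK d 0 0 (Pi.single i 1) ^ 2 := by
  have h : srwK d 0 0 (Pi.single i 1) = (∫ k, |Dhat d k| ∂P d) / (2 * π) ^ d := by
    unfold srwK
    congr 1
    refine integral_congr_ae (ae_of_all _ fun k => ?_)
    simp only [DhatSym_single, pow_zero, one_mul, mul_one]
  rw [h]; exact one_div_le_sq_integral_abs_Dhat_div hd

/-- **`I_{0,4}(0) = E[D̂⁴] = 3(2d-1)/(8d³)`** (`d ≥ 1`). [cite: FitznerVanDerHofstad2016NoBLE, (5.15) p. 1092] -/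
theorem srwI_zero_four_zero (hd : 1 ≤ d) :
    srwI d 0 4 0 = 3 * (2 * (d : ℝ) - 1) / (8 * (d : ℝ) ^ 3) := by
  unfold srwI
  have hN : (0 : ℝ) < (2 * π) ^ d := by positivity
  rw [div_eq_iff hN.ne', mul_comm]
  have h := integral_Dhat_pow_four d hd
  rw [← h]
  refine integral_congr_ae (ae_of_all _ fun k => ?_)
  simp only [DhatSym_zero, mul_one, pow_zero]

/-- **`I_{0,2}(0) = E[D̂²] = 1/(2d)`** (`d ≥ 1`). [cite: FitznerVanDerHofstad2016NoBLE, (5.15) p. 1092] -/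
theorem srwI_zero_two_zero (hd : 1 ≤ d) :
    srwI d 0 2 0 = 1 / (2 * (d : ℝ)) := by
  unfold srwI
  have hN : (0 : ℝ) < (2 * π) ^ d := by positivity
  rw [div_eq_iff hN.ne', show 1 / (2 * (d : ℝ)) * (2 * π) ^ d = (2 * π) ^ d / (2 * d) by ring]
  rw [← integral_Dhat_sq' d hd]
  refine integral_congr_ae (ae_of_all _ fun k => ?_)
  simp only [DhatSym_zero, mul_one, pow_zero]

end Literature.Probability.FitznerVanDerHofstad2017

end


noncomputable section

namespace Literature.Probability.FitznerVanDerHofstad2017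

open Finset MeasureTheory Real

variable {d : ℕ}

/-- **Exact supremum of `K_{0,2}` over `{‖x‖₁ ≥ 2}` (upper bound), every `d ≥ 10`**:
`K_{0,2}(x) ≤ κ_d/(2d)` for all `x ∈ ℤ^d` with `Σ|x_μ| ≥ 2`, where `κ_d = K_{0,0}(e_0)`; equality holds
on the whole axis family `m e_i`, `|m| ≥ 2` (`srwK_zero_two_single_eq_kappa_div`).
[cite: FitznerVanDerHofstad2016NoBLE, (5.15)–(5.16) p. 1092 and Lemma 5.1 p. 1093] -/
theorem srwK_zero_two_le_kappa_div (hd : 10 ≤ d) (x : Fin d → ℤ) (hx : 2 ≤ ∑ j, |x j|) :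
    srwK d 0 2 x ≤ srwK d 0 0 (Pi.single (⟨0, by omega⟩ : Fin d) 1) / (2 * d) := by
  refine srwK_zero_two_le_kappa_div_of_inputs hd (fun y hy => ?_) (srwI_zero_four_zero (by omega))
    (srwK_nonneg 0 0 _) (one_div_le_srwK_zero_zero_single_sq (by omega) _) x hx
  exact srwL_zero_le_of_two_le_card_support (by omega) y hy

end Literature.Probability.FitznerVanDerHofstad2017

end
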